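import Literature.RingTheory.FormalGroups.FunctionalEquationCongruence
import HarnessLib

/-!
# Hazewinkel's functional equation lemma, II: the lemma (master form) ([Hazewinkel 1978] Ch. I §2.2 (i)–(ii), proof §2.4)

Topic `Literature/RingTheory/FormalGroups`; namespace `Literature.RingTheory.FormalGroups`.  THEOREMS only (no definition,
no named fact, no instance, no notation, no `sorry`).  Sequel of `FunctionalEquationCongruence.lean` (setting, `feDefectCoeff`,
Frobenius congruence, part (iv)).  Cell `hodgecm-mathlib`, P6 «MOD programme» ROW 4B, letter L4B.3c𝒪.

Setting as in part I: `A ≤ K`, `σ` with `σ(A) ⊆ A` and `σ(a) ≡ a^q (mod ϖA)`, `p ∈ ϖA`, `q = p^f`, `σ^k(s_i)ϖ ∈ A`.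
A series `ψ = Σ_{n ≥ 1} a_n X^n`, `a_1 = 1`, is of functional-equation type when `a_n − Σ_{q^i ∣ n} s_i σ^i(a_{n/q^i}) ∈ A`
for all `n` ([Hazewinkel1978] (2.1.5)–(2.1.8): `ψ = f_g`, `g ∈ A⟦X⟧`).

* `coeff_mul_pow_mem_of_feDefect` — sub-lemma of §2.4: `σ^k(a_n)·ϖ^v ∈ A` whenever `q^{v+1} ∤ n` ("`a_n 𝔞^{v_q(n)} ⊆ A`").
* `coeff_mem_of_feDefect_psubst_mem` — **the functional equation lemma, master form**: if `ψ` is of functional-equation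
  type, `h ∈ K⟦X_τ⟧` has no constant term, and `ψ(h)` is of functional-equation type (all its defects
  `[X^d]ψ(h) − Σ_i s_i[X^d](σ^i_*ψ(h))(X^{q^i})` lie in `A`), then `h ∈ A⟦X_τ⟧`.  Hazewinkel's (i)
  `F(X,Y) = ψ⁻¹(ψ(X) + ψ(Y)) ∈ A⟦X,Y⟧` is the case `ψ(h) = ψ(X) + ψ(Y)`, his (ii) `ψ⁻¹(ψ̂(X)) ∈ A⟦X⟧` the case `ψ(h) = ψ̂`;
  the `[c]`-series `ψ⁻¹(c·ψ)` of the universal formal `𝒪`-module law is the case `ψ(h) = c·ψ` (`σ(c) = c ∈ A`).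

THE PROOF (§2.4, coefficient of `X^d`, `|d| = n`, assuming the coefficients of `h` of degree `< n` lie in `A`, `h'` = that
truncation): `[X^d]ψ(h) = [X^d]h + [X^d]ψ(h')`; `[X^d]ψ(h') = Σ_m g_m[X^d]h'^m + Σ_i s_i [X^d]ψ_i(h')` with
`ψ_i = (σ^i_*ψ)(X^{q^i})`, `g = ψ − Σ s_iψ_i ∈ A⟦X⟧`; `ψ_i(h') = (σ^i_*ψ)(h'^{q^i}) ≡ (σ^i_*ψ)((σ^i_*h')(X^{q^i})) (mod ϖ)`
(Frobenius congruence + part (iv)), so `s_i[X^d]ψ_i(h') ≡ s_i[X^d](σ^i_*ψ(h'))(X^{q^i}) = s_i[X^d](σ^i_*ψ(h))(X^{q^i})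
(mod A)`; hence `[X^d]h ≡ defect(ψ(h), d) ≡ 0 (mod A)`.

## References
* M. Hazewinkel, *Formal Groups and Applications*, Academic Press (1978), Ch. I §2.2 "The functional equation lemma"
  (i), (ii), §2.4 (proof). [Hazewinkel1978]
-/

noncomputable section

namespace Literature.RingTheory.FormalGroups

open MvPowerSeries

universe u v

variable {K : Type u} [CommRing K] {τ : Type v}

/-! ## §5 The coefficients of a series of functional-equation type -/

section Coefficients

variable (A : Subring K)

/-- `σ^k` preserves `A` when `σ` does. [folklore] -/
private theorem iterate_mem (σ : K →+* K) (hσA : ∀ a ∈ A, σ a ∈ A) : ∀ (k : ℕ) (a : K), a ∈ A → (σ ^ k) a ∈ A := by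
  intro k
  induction k with
  | zero => intro a ha; simpa using ha
  | succ k ih => intro a ha; rw [pow_succ', RingHom.coe_mul, Function.comp_apply]; exact hσA _ (ih a ha)

/-- The coefficients of `(σ^i_* ψ)(X^{Q})`: `[X^n] = σ^i(a_{n/Q})` if `Q ∣ n`, else `0`. [folklore] -/
private theorem coeff_expand_map (σ : K →+* K) {Q : ℕ} (hQ : Q ≠ 0) (i : ℕ) (ψ : PowerSeries K) (n : ℕ) :
    PowerSeries.coeff n (PowerSeries.expand Q hQ (PowerSeries.map (σ ^ i) ψ)) =
      if Q ∣ n then (σ ^ i) (PowerSeries.coeff (n / Q) ψ) else 0 := by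
  rw [PowerSeries.coeff_expand]
  split_ifs with h
  · rw [PowerSeries.coeff_map]
  · rfl

/-- **Sub-lemma of [Hazewinkel1978] §2.4**: if `ψ = Σ a_n X^n` is of functional-equation type then
`σ^k(a_n) · ϖ^v ∈ A` whenever `q^{v+1} ∤ n` (all `k ≥ 0`) — Hazewinkel's "`a_n 𝔞^{v_q(n)} ⊆ A`", in the `σ`-stable form the
induction requires.  (By the recursion `a_n = g_n + Σ_{q^i ∣ n} s_i σ^i(a_{n/q^i})` and `σ^k(s_i)ϖ ∈ A`.)
[cite: Hazewinkel1978, §2.4] -/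
theorem coeff_mul_pow_mem_of_feDefect (σ : K →+* K) {ϖ : K} (hϖ : ϖ ∈ A) {q : ℕ} (hq2 : 2 ≤ q) (s : ℕ → K)
    (hσA : ∀ a ∈ A, σ a ∈ A) (hs : ∀ i k : ℕ, 1 ≤ i → (σ ^ k) (s i) * ϖ ∈ A) (ψ : PowerSeries K)
    (hψ : ∀ n, PowerSeries.coeff n ψ - ∑ i ∈ Finset.Icc 1 n,
      s i * PowerSeries.coeff n (PowerSeries.expand (q ^ i) (pow_ne_zero i (by omega)) (PowerSeries.map (σ ^ i) ψ)) ∈ A) :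
    ∀ (n k v : ℕ), ¬ q ^ (v + 1) ∣ n → (σ ^ k) (PowerSeries.coeff n ψ) * ϖ ^ v ∈ A := by
  have hq0 : q ≠ 0 := by omega
  intro n
  induction n using Nat.strong_induction_on with
  | _ n ih =>
    intro k v hv
    -- the recursion for `a_n`
    set g : K := PowerSeries.coeff n ψ - ∑ i ∈ Finset.Icc 1 n,
      s i * PowerSeries.coeff n (PowerSeries.expand (q ^ i) (pow_ne_zero i hq0) (PowerSeries.map (σ ^ i) ψ)) with hg
    have hgA : g ∈ A := hψ n
    have han : PowerSeries.coeff n ψ = g + ∑ i ∈ Finset.Icc 1 n,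
        s i * PowerSeries.coeff n (PowerSeries.expand (q ^ i) (pow_ne_zero i hq0) (PowerSeries.map (σ ^ i) ψ)) := by
      rw [hg]; ring
    rw [han, map_add, map_sum, add_mul, Finset.sum_mul]
    refine A.add_mem (A.mul_mem (iterate_mem A σ hσA k g hgA) (A.pow_mem hϖ v)) (A.sum_mem fun i hi => ?_)
    rw [Finset.mem_Icc] at hi
    rw [coeff_expand_map, map_mul]
    split_ifs with hdvd
    · -- `q^i ∣ n`: `σ^k(s_i) σ^{k+i}(a_{n/q^i}) ϖ^v = (σ^k(s_i) ϖ)(σ^{k+i}(a_{n/q^i}) ϖ^{v-1})`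
      obtain ⟨n', hn'⟩ := hdvd
      have hiv : i ≤ v := by
        by_contra hcon
        apply hv
        rw [hn']
        exact Dvd.dvd.mul_right (pow_dvd_pow q (by omega)) n'
      have hn'0 : n' ≠ 0 := by
        rintro rfl
        rw [mul_zero] at hn'
        rw [hn'] at hi
        omega
      have hn'lt : n' < n := by
        rw [hn']
        have : 2 ≤ q ^ i := le_trans hq2 (by
          calc q = q ^ 1 := (pow_one q).symm
            _ ≤ q ^ i := Nat.pow_le_pow_right (by omega) hi.1)
        nlinarith [Nat.pos_of_ne_zero hn'0]
      have hdiv : n / q ^ i = n' := by rw [hn', Nat.mul_div_cancel_left _ (pow_pos (by omega) i)]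
      have hv' : ¬ q ^ (v - i + 1) ∣ n' := by
        rintro ⟨t, ht⟩
        apply hv
        refine ⟨q ^ (v - i) * q ^ i * 0 + t, ?_⟩
        rw [hn', ht, mul_zero, zero_add, ← mul_assoc, ← pow_add, show i + (v - i + 1) = v + 1 by omega]
      have hrec := ih n' hn'lt (k + i) (v - i) hv'
      rw [pow_add, RingHom.coe_mul, Function.comp_apply] at hrec
      rw [hdiv]
      have hsplit : ϖ ^ v = ϖ * ϖ ^ (v - i) * ϖ ^ (i - 1) := by
        rw [mul_assoc, ← pow_add, ← pow_succ', show v - i + (i - 1) + 1 = v by omega]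
      rw [hsplit]
      have := A.mul_mem (A.mul_mem (hs i k hi.1) hrec) (A.pow_mem hϖ (i - 1))
      convert this using 1
      ring
    · rw [map_zero, mul_zero, zero_mul]; exact A.zero_mem

end Coefficients

/-! ## §6 The functional equation lemma (master form) -/

section Master

variable (A : Subring K)

/-- Coefficients of `(ρ_* x)(X_τ^Q)` lie in `A` when those of `x` do and `ρ(A) ⊆ A`. [folklore] -/
private theorem coeff_expand_map_mem (ρ : K →+* K) (hρA : ∀ a ∈ A, ρ a ∈ A) {Q : ℕ} (hQ : Q ≠ 0)
    {x : MvPowerSeries τ K} (hx : ∀ d, coeff d x ∈ A) (d : τ →₀ ℕ) : coeff d (expand Q hQ (map ρ x)) ∈ A := by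
  classical
  by_cases h : ∀ t, Q ∣ d t
  · have hd : d = Q • d.mapRange (· / Q) (by simp) := by
      ext t
      simp only [Finsupp.coe_smul, Finsupp.mapRange_apply, Pi.smul_apply, smul_eq_mul]
      exact (Nat.mul_div_cancel' (h t)).symm
    rw [coeff_expand_of_eq_smul hQ _ hd, coeff_map]
    exact hρA _ (hx _)
  · push Not at h
    obtain ⟨t, ht⟩ := h
    rw [coeff_expand_of_not_dvd Q hQ _ ht]
    exact A.zero_mem

/-- Congruent series have the same `[X^d](ρ_* ·)(X^Q)` as long as they agree below `|d|` (`Q ≥ 2`). [folklore] -/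
private theorem coeff_expand_map_congr (ρ : K →+* K) {Q : ℕ} (hQ : Q ≠ 0) (hQ2 : 2 ≤ Q) {x y : MvPowerSeries τ K}
    {n : ℕ} (hxy : (n : ℕ∞) ≤ (x - y).order) (d : τ →₀ ℕ) (hd : d.degree ≤ n) (hd0 : d ≠ 0) :
    coeff d (expand Q hQ (map ρ x)) = coeff d (expand Q hQ (map ρ y)) := by
  classical
  by_cases h : ∀ t, Q ∣ d t
  · have hde : d = Q • d.mapRange (· / Q) (by simp) := by
      ext t
      simp only [Finsupp.coe_smul, Finsupp.mapRange_apply, Pi.smul_apply, smul_eq_mul]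
      exact (Nat.mul_div_cancel' (h t)).symm
    set e := d.mapRange (· / Q) (by simp) with he
    have he0 : e ≠ 0 := by rintro h0; rw [h0, smul_zero] at hde; exact hd0 hde
    have hedeg : e.degree < n := by
      have h1 : d.degree = Q * e.degree := by
        conv_lhs => rw [hde]
        rw [map_nsmul, smul_eq_mul]
      have h2 : 0 < e.degree := Nat.pos_of_ne_zero (fun h0 => he0 ((Finsupp.degree_eq_zero_iff e).mp h0))
      nlinarith
    rw [coeff_expand_of_eq_smul hQ _ hde, coeff_expand_of_eq_smul hQ _ hde, coeff_map, coeff_map,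
      (natCast_le_order_sub_iff.mp hxy) e hedeg]
  · push Not at h
    obtain ⟨t, ht⟩ := h
    rw [coeff_expand_of_not_dvd Q hQ _ ht, coeff_expand_of_not_dvd Q hQ _ ht]

/-- **Hazewinkel's functional equation lemma, master form** ([Hazewinkel1978] §2.2 (i)–(ii), proof §2.4).  Data: a subring
`A ≤ K`, a ring endomorphism `σ` of `K` with `σ(A) ⊆ A`, `ϖ ∈ A` and a prime `p` with `p ∈ ϖA`, `q = p^f` (`f ≥ 1`) with
`σ(a) ≡ a^q (mod ϖA)` on `A`, and `s_i ∈ K` (`i ≥ 1`) with `σ^k(s_i)ϖ ∈ A`.  Let `ψ = Σ_{n≥1} a_n X^n`, `a_1 = 1`, be of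
functional-equation type (`a_n − Σ_{q^i∣n} s_i σ^i(a_{n/q^i}) ∈ A`), and let `h ∈ K⟦X_τ⟧` have no constant term.  If `ψ(h)`
is of functional-equation type — all its defects `[X^d]ψ(h) − Σ_i s_i [X^d](σ^i_*ψ(h))(X^{q^i})` lie in `A` — then `h` has
coefficients in `A`.  Special cases: (i) `h = ψ⁻¹(ψ(X) + ψ(Y))` (the formal group law of `ψ`), (ii) `h = ψ⁻¹(ψ̂)`,
and `h = ψ⁻¹(c·ψ)` for `σ(c) = c ∈ A` (the `[c]`-series). [cite: Hazewinkel1978, §2.2 Functional equation lemma (i)(ii), §2.4] -/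
theorem coeff_mem_of_feDefect_psubst_mem (σ : K →+* K) {ϖ : K} (hϖ : ϖ ∈ A) {p : ℕ} (hp : p.Prime) {f : ℕ} (hf : 1 ≤ f)
    {q : ℕ} (hq0 : q ≠ 0) (hq : q = p ^ f) (s : ℕ → K)
    (hpϖ : ∃ w ∈ A, (p : K) = ϖ * w) (hσA : ∀ a ∈ A, σ a ∈ A) (hσ : ∀ a ∈ A, ∃ b ∈ A, σ a = a ^ q + ϖ * b)
    (hs : ∀ i k : ℕ, 1 ≤ i → (σ ^ k) (s i) * ϖ ∈ A)
    (ψ : PowerSeries K) (hψ0 : PowerSeries.constantCoeff ψ = 0) (hψ1 : PowerSeries.coeff 1 ψ = 1)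
    (hψ : ∀ n, PowerSeries.coeff n ψ - ∑ i ∈ Finset.Icc 1 n,
      s i * PowerSeries.coeff n (PowerSeries.expand (q ^ i) (pow_ne_zero i hq0) (PowerSeries.map (σ ^ i) ψ)) ∈ A)
    {h : MvPowerSeries τ K} (hh : constantCoeff h = 0)
    (hΦ : ∀ d, feDefectCoeff σ q hq0 s (PowerSeries.subst h ψ) d ∈ A) :
    ∀ d, coeff d h ∈ A := by
  classical
  have hq2 : 2 ≤ q := by rw [hq]; exact le_trans hp.two_le (Nat.le_self_pow (by omega) p)
  obtain ⟨w, hw, hpw⟩ := hpϖ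
  have hσϖ : ∃ c ∈ A, σ ϖ = ϖ * c := by
    obtain ⟨b, hb, hσb⟩ := hσ ϖ hϖ
    refine ⟨ϖ ^ (q - 1) + b, A.add_mem (A.pow_mem hϖ _) hb, ?_⟩
    rw [hσb, mul_add, ← pow_succ', Nat.sub_add_cancel (by omega)]
  have hσAk := iterate_mem A σ hσA
  have hσk := exists_iterate_eq_pow_add A σ q hσA hσ hσϖ
  have hdiv := coeff_mul_pow_mem_of_feDefect A σ hϖ hq2 s hσA hs ψ hψ
  set Φ := PowerSeries.subst h ψ with hΦdef
  -- induction on the total degree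
  suffices main : ∀ n : ℕ, ∀ d : τ →₀ ℕ, d.degree < n → coeff d h ∈ A from
    fun d => main (d.degree + 1) d (Nat.lt_succ_self _)
  intro n
  induction n with
  | zero => intro d hd; omega
  | succ n ih =>
    intro d hd
    rcases (Nat.lt_succ_iff.mp hd).lt_or_eq with hlt | hdn
    · exact ih d hlt
    rcases Nat.eq_zero_or_pos n with hn0 | hn
    · rw [hn0, Finsupp.degree_eq_zero_iff] at hdn
      rw [hdn, coeff_zero_eq_constantCoeff_apply, hh]
      exact A.zero_mem
    have hd0 : d ≠ 0 := fun h0 => by rw [h0, map_zero] at hdn; omega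
    -- the truncation `h'` of `h` below degree `n`
    set h' : MvPowerSeries τ K := fun e => if e.degree < n then coeff e h else 0 with hh'def
    have hh'c : ∀ e, coeff e h' = if e.degree < n then coeff e h else 0 := fun e => rfl
    have hh'A : ∀ e, coeff e h' ∈ A := fun e => by
      rw [hh'c]; split_ifs with he
      · exact ih e he
      · exact A.zero_mem
    have hh'0 : constantCoeff h' = 0 := by
      rw [← coeff_zero_eq_constantCoeff_apply, hh'c, if_pos (by rw [map_zero]; exact hn),
        coeff_zero_eq_constantCoeff_apply, hh]
    have hord : (n : ℕ∞) ≤ (h - h').order := by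
      rw [natCast_le_order_sub_iff]
      intro e he
      rw [hh'c, if_pos he]
    have hdh' : coeff d h' = 0 := by rw [hh'c, if_neg (by omega)]
    -- (1) `[X^d]ψ(h) = [X^d]h + [X^d]ψ(h')`
    have e1 : coeff d Φ = coeff d h + coeff d (PowerSeries.subst h' ψ) := by
      rw [hΦdef, coeff_psubst_eq_sum hh ψ d, coeff_psubst_eq_sum hh'0 ψ d, ← sub_eq_iff_eq_add,
        ← Finset.sum_sub_distrib]
      rw [Finset.sum_eq_single 1]
      · rw [hψ1, pow_one, pow_one, one_mul, one_mul, hdh', sub_zero]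
      · intro m _ hm1
        rcases Nat.eq_zero_or_pos m with rfl | hm
        · rw [pow_zero, pow_zero, sub_self]
        · have hm2 : 2 ≤ m := by omega
          rw [← mul_sub, ← map_sub]
          have hpow := le_order_pow_sub_pow hh hh'0 hord m (by omega)
          have hlt : (d.degree : ℕ∞) < (h ^ m - h' ^ m).order :=
            lt_of_lt_of_le (by exact_mod_cast (show d.degree < n + m - 1 by omega)) hpow
          rw [coeff_of_lt_order hlt, mul_zero]
      · intro h1; exact absurd (Finset.mem_range.mpr (by omega)) h1
    -- (2) `[X^d]ψ(h') = Σ_m g_m [X^d]h'^m + Σ_i s_i [X^d] ψ_i(h')`, `ψ_i = (σ^i_*ψ)(X^{q^i})`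
    set ψi : ℕ → PowerSeries K := fun i =>
      PowerSeries.expand (q ^ i) (pow_ne_zero i hq0) (PowerSeries.map (σ ^ i) ψ) with hψidef
    set g : ℕ → K := fun m => PowerSeries.coeff m ψ - ∑ i ∈ Finset.Icc 1 m, s i * PowerSeries.coeff m (ψi i) with hgdef
    have hgA : ∀ m, g m ∈ A := fun m => hψ m
    have hψi0 : ∀ i m, 1 ≤ i → m < q ^ i → PowerSeries.coeff m (ψi i) = 0 := by
      intro i m hi hm
      rw [hψidef]
      simp only
      rw [coeff_expand_map]
      split_ifs with hdvd
      · rcases Nat.eq_zero_or_pos m with rfl | hm0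
        · rw [Nat.zero_div, PowerSeries.coeff_zero_eq_constantCoeff_apply, hψ0, map_zero]
        · exact absurd (Nat.le_of_dvd hm0 hdvd) (by omega)
      · rfl
    have hlt_pow : ∀ i m : ℕ, m < i → m < q ^ i := fun i m hmi =>
      lt_of_lt_of_le hmi (le_of_lt (Nat.lt_pow_self (by omega)))
    have e2 : coeff d (PowerSeries.subst h' ψ) =
        (∑ m ∈ Finset.range (n + 1), g m * coeff d (h' ^ m)) +
          ∑ i ∈ Finset.Icc 1 n, s i * coeff d (PowerSeries.subst h' (ψi i)) := by
      rw [coeff_psubst_eq_sum hh'0 ψ d, hdn]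
      have hsplit : ∀ m ∈ Finset.range (n + 1), PowerSeries.coeff m ψ * coeff d (h' ^ m) =
          g m * coeff d (h' ^ m) + ∑ i ∈ Finset.Icc 1 n, s i * (PowerSeries.coeff m (ψi i) * coeff d (h' ^ m)) := by
        intro m hm
        rw [Finset.mem_range] at hm
        have hext : ∑ i ∈ Finset.Icc 1 m, s i * PowerSeries.coeff m (ψi i) =
            ∑ i ∈ Finset.Icc 1 n, s i * PowerSeries.coeff m (ψi i) := by
          apply Finset.sum_subset (Finset.Icc_subset_Icc_right (by omega))
          intro i hi hi'
          rw [Finset.mem_Icc] at hi hi'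
          rw [hψi0 i m hi.1 (hlt_pow i m (by omega)), mul_zero]
        rw [hgdef]
        simp only
        rw [hext, sub_mul, Finset.sum_mul]
        simp only [mul_assoc]
        ring
      rw [Finset.sum_congr rfl hsplit, Finset.sum_add_distrib, Finset.sum_comm]
      congr 1
      refine Finset.sum_congr rfl fun i _ => ?_
      rw [← Finset.mul_sum, coeff_psubst_eq_sum hh'0 (ψi i) d, hdn]
    -- the first sum lies in `A`
    have hS1 : (∑ m ∈ Finset.range (n + 1), g m * coeff d (h' ^ m)) ∈ A :=
      A.sum_mem fun m _ => A.mul_mem (hgA m) (coeff_pow_mem_subring A hh'A m d)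
    -- (3)+(4) each `s_i [X^d]ψ_i(h')` is `≡ s_i [X^d](σ^i_*Φ)(X^{q^i}) (mod A)`
    have e34 : ∀ i ∈ Finset.Icc 1 n, s i * coeff d (PowerSeries.subst h' (ψi i)) -
        s i * coeff d (expand (q ^ i) (pow_ne_zero i hq0) (map (σ ^ i) Φ)) ∈ A := by
      intro i hi
      rw [Finset.mem_Icc] at hi
      have hqi0 : q ^ i ≠ 0 := pow_ne_zero i hq0
      have hqi2 : 2 ≤ q ^ i := le_trans hq2 (by
        calc q = q ^ 1 := (pow_one q).symm
          _ ≤ q ^ i := Nat.pow_le_pow_right (by omega) hi.1)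
      -- `ψ_i(h') = (σ^i_*ψ)(h'^{q^i})`
      have hsub : PowerSeries.subst h' (ψi i) = PowerSeries.subst (h' ^ (q ^ i)) (PowerSeries.map (σ ^ i) ψ) := by
        rw [hψidef]
        simp only
        rw [PowerSeries.expand_apply, PowerSeries.subst_comp_subst_apply
          (PowerSeries.HasSubst.of_constantCoeff_zero' (by rw [map_pow, PowerSeries.constantCoeff_X, zero_pow hqi0]))
          (PowerSeries.HasSubst.of_constantCoeff_zero hh'0)]
        congr 1
        rw [← PowerSeries.coe_substAlgHom (PowerSeries.HasSubst.of_constantCoeff_zero hh'0), map_pow,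
          PowerSeries.coe_substAlgHom, PowerSeries.subst_X (PowerSeries.HasSubst.of_constantCoeff_zero hh'0)]
      -- `u_i = (σ^i_* h')(X^{q^i})`
      set u : MvPowerSeries τ K := expand (q ^ i) hqi0 (map (σ ^ i) h') with hudef
      have huA : ∀ e, coeff e u ∈ A := coeff_expand_map_mem A (σ ^ i) (hσAk i) hqi0 hh'A
      have hu0 : constantCoeff u = 0 := by
        rw [hudef, constantCoeff_expand, constantCoeff_map, hh'0, map_zero]
      have hα0 : constantCoeff (h' ^ (q ^ i)) = 0 := by rw [map_pow, hh'0, zero_pow hqi0]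
      -- Frobenius: `h'^{q^i} ≡ u (mod ϖ)`
      have hfrob := exists_coeff_pow_sub_expand_map_eq_mul A (σ ^ i) hϖ hp (f * i) hqi0
        (by rw [hq, ← pow_mul]) ⟨w, hw, hpw⟩ (hσAk i) (hσk i) hh'A
      -- part (iv) for `σ^i_* ψ`
      have hdivi : ∀ m v : ℕ, ¬ (p ^ f) ^ (v + 1) ∣ m →
          PowerSeries.coeff m (PowerSeries.map (σ ^ i) ψ) * ϖ ^ v ∈ A := by
        intro m v hmv
        rw [PowerSeries.coeff_map]
        exact hdiv m i v (by rw [hq]; exact hmv)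
      obtain ⟨b, hb, hbeq⟩ := exists_coeff_psubst_sub_psubst_eq_mul A hϖ hw hp hpw hf (PowerSeries.map (σ ^ i) ψ)
        hdivi hα0 hu0 (coeff_pow_mem_subring A hh'A _) huA hfrob d
      -- (4) `(σ^i_*ψ)(u_i) = (σ^i_*(ψ(h')))(X^{q^i})`, whose `d`-coefficient is that of `(σ^i_*Φ)(X^{q^i})`
      have hsub2 : PowerSeries.subst u (PowerSeries.map (σ ^ i) ψ) =
          expand (q ^ i) hqi0 (map (σ ^ i) (PowerSeries.subst h' ψ)) := by
        rw [hudef, ← PowerSeries.expand_subst _ hqi0 (PowerSeries.HasSubst.of_constantCoeff_zero (by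
          rw [constantCoeff_map, hh'0, map_zero])), ← PowerSeries.map_subst (PowerSeries.HasSubst.of_constantCoeff_zero hh'0)]
      have hord' : (n : ℕ∞) ≤ (PowerSeries.subst h' ψ - Φ).order :=
        natCast_le_order_sub_comm (le_order_psubst_sub_psubst' ψ hh hh'0 hord)
      have hcongr : coeff d (expand (q ^ i) hqi0 (map (σ ^ i) (PowerSeries.subst h' ψ))) =
          coeff d (expand (q ^ i) hqi0 (map (σ ^ i) Φ)) :=
        coeff_expand_map_congr (σ ^ i) hqi0 hqi2 hord' d (le_of_eq hdn) hd0
      rw [hsub, ← hcongr, ← hsub2, ← mul_sub, ← map_sub, hbeq, ← mul_assoc]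
      have := A.mul_mem (hs i 0 hi.1) hb
      simpa using this
    -- (5) assemble with the defect of `Φ` at `d`
    have hdef := hΦ d
    rw [feDefectCoeff_def, hdn] at hdef
    have hS2 : (∑ i ∈ Finset.Icc 1 n, s i * coeff d (PowerSeries.subst h' (ψi i))) -
        ∑ i ∈ Finset.Icc 1 n, s i * coeff d (expand (q ^ i) (pow_ne_zero i hq0) (map (σ ^ i) Φ)) ∈ A := by
      rw [← Finset.sum_sub_distrib]
      exact A.sum_mem e34
    have key : coeff d h = (coeff d Φ - ∑ i ∈ Finset.Icc 1 n,
        s i * coeff d (expand (q ^ i) (pow_ne_zero i hq0) (map (σ ^ i) Φ))) -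
        (∑ m ∈ Finset.range (n + 1), g m * coeff d (h' ^ m)) -
        ((∑ i ∈ Finset.Icc 1 n, s i * coeff d (PowerSeries.subst h' (ψi i))) -
          ∑ i ∈ Finset.Icc 1 n, s i * coeff d (expand (q ^ i) (pow_ne_zero i hq0) (map (σ ^ i) Φ))) := by
      rw [e1, e2]; ring
    rw [key]
    exact A.sub_mem (A.sub_mem hdef hS1) hS2

end Master

end Literature.RingTheory.FormalGroups
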